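import Literature.MathematicalPhysics.KineticTheory.CollisionTubePairMean
import HarnessLib

/-!
# The collision-tube functional has the Enskog mean at rung 0, at each fixed time, conditionally on the
# contact hypothesis

Topic `Literature/MathematicalPhysics/KineticTheory` (kind proof; the static TUBE-side estimate of the
Enskog closure at rung 0, crux line `even-rung-mean-variance` of `JParityClosure.EvenStressEnskog`,
stmt-AtomisticToContinuum-13079).  For constant profiles `(a, u, θ)`, `N + 1` spheres of diameter
`ε = σ(N+1)^{-1/3}`, the rung-0 local Gibbs law `G_N`, the truncated even mark `Ξ_L`, and a fixed time
label `t`, the Gibbs mean of the fixed-time collision-tube functional `A_t = tubeStat σ N χ g Ξ_L r r 1 κ t`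
is within

  `σ³ C_g C_χ · 4L²|S²| · ζ + κ⁻¹ · 2L·125 · C_χ (ζ' + 2 C_g P_N(Bad)) + (σ³/(N+1)) C_g C_χ |Y| |Θ̄_L|`

of the Enskog value `σ³ g(σ³) Y Θ̄_L ∫ χ(t, ·)` (`abs_integral_tubeStat_sub_le`), GIVEN the contact
hypothesis for every ordered pair at accuracy `ζ` on the shell of width `δ ≥ 2Lκ` (an argument), the
continuity modulus `ζ'` of `g` at `σ³` at scale `δ''`, and `2Lκ ≤ 1`.  Assembly of
`tubeStat_one_eq_sum_tubeMark` (double-sum form), `pair_tubeMark_mean` (each of the `(N+1)N` ordered pairs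
has the Enskog mean `(∫χ) Y ε³ κ Θ̄_L` up to `C_χ ζ ε³ κ 4L²|S²|`, and `(N+1) ε³ = σ³`) and
`integral_sum_densityWeight_tubeMark_le` (freezing the density weight at `g(σ³)`).

References: H. van Beijeren, M. H. Ernst, Physica 68 (1973) [VanbeijerenErnst1973]; C. Cercignani,
R. Illner, M. Pulvirenti (1994) §2.2 [CIPDiluteGases1994]; H. Spohn (1991) Part I §2.3 [Spohn1991].
-/

noncomputable section

namespace Literature.MathematicalPhysics.KineticTheory

open _root_.MeasureTheory _root_.ProbabilityTheory Set Filter _root_.Topology Function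
open scoped ENNReal BigOperators InnerProductSpace Pointwise
open Literature.Analysis.FluidPDE

/-! ## Sums over ordered pairs -/

/-- `Σᵢ Σⱼ [i ≠ j] c = (N+1) N c` on `Fin (N+1)`. [folklore] -/
theorem sum_sum_ite_ne_const (N : ℕ) (c : ℝ) :
    (∑ i : Fin (N + 1), ∑ j : Fin (N + 1), if i ≠ j then c else 0) = ((N + 1 : ℕ) : ℝ) * N * c := by
  have hinner : ∀ i : Fin (N + 1), (∑ j : Fin (N + 1), if i ≠ j then c else 0) = (N : ℝ) * c := by
    intro i
    rw [← Finset.sum_filter, Finset.filter_ne, Finset.sum_const, Finset.card_erase_of_mem (Finset.mem_univ i),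
      Finset.card_univ, Fintype.card_fin, nsmul_eq_mul]
    push_cast
    ring
  simp only [hinner, Finset.sum_const, Finset.card_univ, Fintype.card_fin, nsmul_eq_mul]
  ring

/-- `|Σᵢ Σⱼ aᵢⱼ − Σᵢ Σⱼ bᵢⱼ| ≤ Σᵢ Σⱼ |aᵢⱼ − bᵢⱼ|`. [folklore] -/
theorem abs_sum_sum_sub_le {n : ℕ} (a b : Fin n → Fin n → ℝ) :
    |(∑ i, ∑ j, a i j) - ∑ i, ∑ j, b i j| ≤ ∑ i, ∑ j, |a i j - b i j| := by
  rw [← Finset.sum_sub_distrib]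
  refine (Finset.abs_sum_le_sum_abs _ _).trans (Finset.sum_le_sum fun i _ => ?_)
  rw [← Finset.sum_sub_distrib]
  exact Finset.abs_sum_le_sum_abs _ _

/-! ## Measurability of the summands of the tube functional -/

section Summands

variable {N : ℕ}

/-- The positions and velocities of a configuration, as a measurable map. [folklore] -/
theorem measurable_posVel :
    Measurable fun z : Config (N + 1) (Fin 3) T3 => ((fun m => (z m).1), (fun m => (z m).2)) :=
  (measurable_pi_lambda _ fun m => (measurable_pi_apply m).fst).prodMk
    (measurable_pi_lambda _ fun m => (measurable_pi_apply m).snd)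

/-- The pair tube mark read on a configuration is measurable. [folklore] -/
theorem measurable_pairTubeMark_config (ε κ : ℝ) {Ξ : V3 × V3 × V3 → ℝ} (hΞ : Measurable Ξ)
    (i j : Fin (N + 1)) :
    Measurable fun z : Config (N + 1) (Fin 3) T3 => pairTubeMark ε κ Ξ i j (fun m => (z m).1) (fun m => (z m).2) := by
  have h := (measurable_pairTubeMark ε κ hΞ i j).comp (measurable_posVel (N := N))
  exact h

/-- The mollified density at particle `i`, read on a configuration, is measurable. [folklore] -/
theorem measurable_empDensity_at (r : ℝ) (i : Fin (N + 1)) :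
    Measurable fun z : Config (N + 1) (Fin 3) T3 => empDensity r (fun m => (z m).1) (z i).1 := by
  have h0 : Measurable fun z : Config (N + 1) (Fin 3) T3 => ((fun m => (z m).1), (z i).1) :=
    (measurable_pi_lambda _ fun m => (measurable_pi_apply m).fst).prodMk (measurable_pi_apply i).fst
  have h := (measurable_empDensity r).comp h0
  exact h

end Summands

/-! ## The fixed-time tube mean at rung 0 under the contact hypothesis -/

/-- **The fixed-time collision-tube functional has the Enskog mean at rung 0, conditionally on the
contact hypothesis.**  Constant profiles `a, θ > 0`, `u`, `0 < σ ≤ 1/2`; continuous `χ` with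
`|χ(t, ·)| ≤ C_χ`; continuous `g` with `|g| ≤ C_g` on `[0, ∞)` and `|g(σ³ y) − g(σ³)| ≤ ζ'` for `y ≥ 0`,
`|y − 1| < δ''`; `L ≥ 0`, `κ > 0`, `2Lκ ≤ min δ 1`, `0 < r`; and the contact hypothesis for every
ordered pair at accuracy `ζ ≥ 0` on the shell of width `δ`.  Then
`|E_{G_N} A_t − σ³ g(σ³) Y Θ̄_L ∫χ(t,·)| ≤ σ³ C_g C_χ 4L²|S²| ζ + κ⁻¹ 2L·125 C_χ (ζ' + 2C_g P_N(Bad)) + σ³/(N+1) · C_g C_χ |Y| |Θ̄_L|`.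
[folklore] -/
theorem abs_integral_tubeStat_sub_le {σ a θ : ℝ} {u : V3} {N : ℕ}
    (Φ : HardSphereFlow (Torus.geometry (Fin 3)) (hsDiameter σ N) (N + 1))
    (hσ : 0 < σ) (hσ2 : σ ≤ 1 / 2) (ha : 0 < a) (hθ : 0 < θ)
    {χ : ℝ × UnitAddTorus (Fin 3) → ℝ} (hχ : Continuous χ) {t Cχ : ℝ} (hCχ : ∀ y, |χ (t, y)| ≤ Cχ)
    {g : ℝ → ℝ} (hg : Continuous g) {Cg : ℝ} (hCg : ∀ y, 0 ≤ y → |g y| ≤ Cg)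
    (k l : Fin 3) {L κ δ ζ ζ' δ'' r : ℝ} (hL : 0 ≤ L) (hκ : 0 < κ) (hζ : 0 ≤ ζ) (hζ' : 0 ≤ ζ')
    (hδ'' : 0 < δ'') (hLκδ : 2 * L * κ ≤ δ) (hLκ : 2 * L * κ ≤ 1) (hr : 0 < r)
    (hmod : ∀ y, 0 ≤ y → |y - 1| < δ'' → |g (σ ^ 3 * y) - g (σ ^ 3)| ≤ ζ')
    (hC : ∀ i j : Fin (N + 1), i ≠ j → ∀ S : Set V3, MeasurableSet S → S ⊆ {q | 1 < ‖q‖ ∧ ‖q‖ ≤ 1 + δ} →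
      |(localGibbsLaw σ (fun _ => a) (fun _ => u) (fun _ => θ) N Φ).real
          {z | Torus.reprSym ((z i).1 - (z j).1) ∈ hsDiameter σ N • S}
        - contactValue (σ ^ 3) * hsDiameter σ N ^ 3 * (volume S).toReal|
        ≤ ζ * hsDiameter σ N ^ 3 * (volume S).toReal) :
    |(∫ z, tubeStat σ N χ g (evenMarkTrunc k l L) r r 1 κ t z
        ∂(localGibbsLaw σ (fun _ => a) (fun _ => u) (fun _ => θ) N Φ)) -
      σ ^ 3 * g (σ ^ 3) * contactValue (σ ^ 3) *
        (∫ p : V3 × V3, sphereMark (evenMarkTrunc k l L) p.1 p.2 *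
          (localMaxwellian 1 θ u p.1 * localMaxwellian 1 θ u p.2)) * ∫ x : UnitAddTorus (Fin 3), χ (t, x)|
      ≤ σ ^ 3 * Cg * Cχ * (2 * L * (2 * L) * (sphereMeasure : Measure (Metric.sphere (0 : V3) 1)).real univ) * ζ
        + κ⁻¹ * (2 * L * 125) * Cχ * (ζ' + 2 * Cg *
          (posGibbsMeasure (fun _ : T3 => a) (hsDiameter σ N) (N + 1)).real (sqDevEvent (N + 1) δ'' r))
        + σ ^ 3 / (N + 1 : ℝ) * Cg * Cχ * |contactValue (σ ^ 3)| *
          |∫ p : V3 × V3, sphereMark (evenMarkTrunc k l L) p.1 p.2 *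
            (localMaxwellian 1 θ u p.1 * localMaxwellian 1 θ u p.2)| := by
  -- abbreviations (plain `have`-equations; the diameter is kept verbatim)
  have hε : 0 < hsDiameter σ N := hsDiameter_pos hσ N
  have hnε : ((N + 1 : ℕ) : ℝ) * hsDiameter σ N ^ 3 = σ ^ 3 := succ_mul_hsDiameter_pow_three σ N
  have hn0 : (0 : ℝ) < (N + 1 : ℕ) := by exact_mod_cast Nat.succ_pos N
  have hCχ0 : 0 ≤ Cχ := (abs_nonneg _).trans (hCχ (0 : UnitAddTorus (Fin 3)))
  have hCg0 : 0 ≤ Cg := (abs_nonneg _).trans (hCg 0 le_rfl)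
  have hgσ : |g (σ ^ 3)| ≤ Cg := hCg _ (by positivity)
  have hΞm : Measurable (evenMarkTrunc k l L) := (continuous_evenMarkTrunc k l L).measurable
  have hΞb : ∀ p, |evenMarkTrunc k l L p| ≤ 2 * L := abs_evenMarkTrunc_le k l hL
  have hΞ0 : ∀ n v v' : V3, ⟪n, v - v'⟫_ℝ = 0 → evenMarkTrunc k l L (n, v, v') = 0 :=
    evenMarkTrunc_eq_zero_of_inner_eq_zero k l hL
  haveI hGprob : IsProbabilityMeasure (localGibbsLaw σ (fun _ => a) (fun _ => u) (fun _ => θ) N Φ) :=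
    isProbabilityMeasure_localGibbsLaw continuous_const continuous_const continuous_const
      (fun _ => ha) (fun _ => hθ) hσ2 N Φ
  have hχt : Continuous fun x : UnitAddTorus (Fin 3) => χ (t, x) := hχ.comp (Continuous.prodMk_right t)
  have hχb : |∫ x : UnitAddTorus (Fin 3), χ (t, x)| ≤ Cχ := by
    have h := norm_integral_le_of_norm_le_const (μ := (volume : Measure (UnitAddTorus (Fin 3))))
      (f := fun x => χ (t, x)) (C := Cχ) (ae_of_all _ fun y => by rw [Real.norm_eq_abs]; exact hCχ y)
    simpa only [Real.norm_eq_abs, probReal_univ, mul_one] using h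
  set G := localGibbsLaw σ (fun _ => a) (fun _ => u) (fun _ => θ) N Φ with hGdef
  set P := posGibbsMeasure (fun _ : T3 => a) (hsDiameter σ N) (N + 1) with hPdef
  set Y := contactValue (σ ^ 3) with hYdef
  set σS := (sphereMeasure : Measure (Metric.sphere (0 : V3) 1)).real univ with hσS
  have hσS0 : 0 ≤ σS := measureReal_nonneg
  set Θb := ∫ p : V3 × V3, sphereMark (evenMarkTrunc k l L) p.1 p.2 *
    (localMaxwellian 1 θ u p.1 * localMaxwellian 1 θ u p.2) with hΘb
  set Iχ := ∫ x : UnitAddTorus (Fin 3), χ (t, x) with hIχ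
  -- the pair tube mark read on a configuration, and the two summand families
  set TM : Fin (N + 1) → Fin (N + 1) → Config (N + 1) (Fin 3) T3 → ℝ := fun i j z =>
    pairTubeMark (hsDiameter σ N) κ (evenMarkTrunc k l L) i j (fun m => (z m).1) (fun m => (z m).2) with hTMdef
  have hTMb : ∀ i j z, |TM i j z| ≤ 2 * L := fun i j z => abs_pairTubeMark_le _ _ hΞb i j _ _
  have hTMm : ∀ i j, Measurable (TM i j) := fun i j => measurable_pairTubeMark_config (hsDiameter σ N) κ hΞm i j
  set S1 : Fin (N + 1) → Fin (N + 1) → Config (N + 1) (Fin 3) T3 → ℝ := fun i j z =>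
    if i ≠ j then χ (t, (z i).1) * g (σ ^ 3) * TM i j z else 0 with hS1def
  set S2 : Fin (N + 1) → Fin (N + 1) → Config (N + 1) (Fin 3) T3 → ℝ := fun i j z =>
    if i ≠ j then χ (t, (z i).1) * (g (σ ^ 3 * empDensity r (fun m => (z m).1) (z i).1) - g (σ ^ 3)) * TM i j z
    else 0 with hS2def
  -- Step 0: the double-sum form of the tube functional
  have hA : ∀ z, tubeStat σ N χ g (evenMarkTrunc k l L) r r 1 κ t z =
      ((N + 1 : ℝ) * κ)⁻¹ * ((∑ i, ∑ j, S1 i j z) + ∑ i, ∑ j, S2 i j z) := by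
    intro z
    rw [tubeStat_one_eq_sum_tubeMark hσ N χ g hΞ0 r r κ t z, ← Finset.sum_add_distrib]
    congr 1
    refine Finset.sum_congr rfl fun i _ => ?_
    rw [← Finset.sum_add_distrib]
    refine Finset.sum_congr rfl fun j _ => ?_
    simp only [hS1def, hS2def, hTMdef, pairTubeMark]
    split_ifs
    · ring
    · simp
  -- measurability and bounds of the summands
  have hχim : ∀ i : Fin (N + 1), Measurable fun z : Config (N + 1) (Fin 3) T3 => χ (t, (z i).1) := fun i => by
    have h0 : Measurable fun z : Config (N + 1) (Fin 3) T3 => (z i).1 := (measurable_pi_apply i).fst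
    have h := hχt.measurable.comp h0
    exact h
  have hgm : ∀ i : Fin (N + 1), Measurable fun z : Config (N + 1) (Fin 3) T3 =>
      g (σ ^ 3 * empDensity r (fun m => (z m).1) (z i).1) - g (σ ^ 3) := fun i => by
    have h := (hg.measurable.comp ((measurable_empDensity_at r i).const_mul (σ ^ 3))).sub
      (measurable_const (a := g (σ ^ 3)))
    exact h
  have hgb : ∀ (i : Fin (N + 1)) (z : Config (N + 1) (Fin 3) T3),
      |g (σ ^ 3 * empDensity r (fun m => (z m).1) (z i).1) - g (σ ^ 3)| ≤ 2 * Cg := fun i z => by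
    have hy : 0 ≤ empDensity r (fun m => (z m).1) (z i).1 := (empDensity_mem_Icc hr _ _).1
    calc _ ≤ |g (σ ^ 3 * empDensity r (fun m => (z m).1) (z i).1)| + |g (σ ^ 3)| := abs_sub _ _
      _ ≤ Cg + Cg := add_le_add (hCg _ (by positivity)) hgσ
      _ = 2 * Cg := by ring
  have hS1m : ∀ i j, Measurable (S1 i j) := fun i j => by
    refine Measurable.ite (MeasurableSet.const _) (((hχim i).mul_const _).mul (hTMm i j)) measurable_const
  have hS2m : ∀ i j, Measurable (S2 i j) := fun i j =>
    Measurable.ite (MeasurableSet.const _) (((hχim i).mul (hgm i)).mul (hTMm i j)) measurable_const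
  have hS1b : ∀ i j z, |S1 i j z| ≤ Cχ * Cg * (2 * L) := fun i j z => by
    simp only [hS1def]
    split_ifs
    · rw [abs_mul, abs_mul]
      exact mul_le_mul (mul_le_mul (hCχ _) hgσ (abs_nonneg _) hCχ0) (hTMb i j z) (abs_nonneg _) (by positivity)
    · rw [abs_zero]; positivity
  have hS2b : ∀ i j z, |S2 i j z| ≤ Cχ * (2 * Cg) * (2 * L) := fun i j z => by
    simp only [hS2def]
    split_ifs
    · rw [abs_mul, abs_mul]
      exact mul_le_mul (mul_le_mul (hCχ _) (hgb i z) (abs_nonneg _) hCχ0) (hTMb i j z) (abs_nonneg _) (by positivity)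
    · rw [abs_zero]; positivity
  have hS1i : ∀ i j, Integrable (S1 i j) G := fun i j =>
    Integrable.of_bound (hS1m i j).aestronglyMeasurable _ (ae_of_all _ fun z => by rw [Real.norm_eq_abs]; exact hS1b i j z)
  have hS2i : ∀ i j, Integrable (S2 i j) G := fun i j =>
    Integrable.of_bound (hS2m i j).aestronglyMeasurable _ (ae_of_all _ fun z => by rw [Real.norm_eq_abs]; exact hS2b i j z)
  -- Step 1: linearity
  have hI : ∫ z, tubeStat σ N χ g (evenMarkTrunc k l L) r r 1 κ t z ∂G =
      ((N + 1 : ℝ) * κ)⁻¹ * ((∑ i, ∑ j, ∫ z, S1 i j z ∂G) + ∫ z, ∑ i, ∑ j, S2 i j z ∂G) := by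
    simp_rw [hA]
    rw [integral_const_mul, integral_add (integrable_finsetSum _ fun i _ => integrable_finsetSum _ fun j _ => hS1i i j)
      (integrable_finsetSum _ fun i _ => integrable_finsetSum _ fun j _ => hS2i i j),
      integral_finsetSum _ fun i _ => integrable_finsetSum _ fun j _ => hS1i i j]
    congr 2
    exact Finset.sum_congr rfl fun i _ => integral_finsetSum _ fun j _ => hS1i i j
  -- Step 2: the main part, pair by pair
  set e₁ : ℝ := Cg * (Cχ * (ζ * hsDiameter σ N ^ 3 * κ * (2 * L * (2 * L) * σS))) with he₁
  have he₁0 : 0 ≤ e₁ := by positivity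
  have hpair : ∀ i j : Fin (N + 1), |(∫ z, S1 i j z ∂G) -
      (if i ≠ j then g (σ ^ 3) * (Iχ * (Y * hsDiameter σ N ^ 3 * κ * Θb)) else 0)| ≤
      if i ≠ j then e₁ else 0 := by
    intro i j
    by_cases hij : i ≠ j
    · rw [if_pos hij, if_pos hij]
      have hm := pair_tubeMark_mean Φ hij hσ hσ2 ha hθ hχt hCχ k l hL hκ.le hζ hLκδ (hC i j hij)
      have hS1 : ∫ z, S1 i j z ∂G = g (σ ^ 3) * ∫ z, χ (t, (z i).1) * TM i j z ∂G := by
        rw [← integral_const_mul]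
        refine integral_congr_ae (ae_of_all _ fun z => ?_)
        simp only [hS1def, if_pos hij]
        ring
      rw [hS1, ← mul_sub, abs_mul, he₁]
      exact mul_le_mul hgσ hm (abs_nonneg _) hCg0
    · rw [if_neg hij, if_neg hij, sub_zero]
      have h0 : ∫ z, S1 i j z ∂G = 0 := by
        simp only [hS1def, if_neg hij, integral_zero]
      rw [h0, abs_zero]
  have hmain : |(∑ i, ∑ j, ∫ z, S1 i j z ∂G) -
      ((N + 1 : ℕ) : ℝ) * N * (g (σ ^ 3) * (Iχ * (Y * hsDiameter σ N ^ 3 * κ * Θb)))| ≤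
      ((N + 1 : ℕ) : ℝ) * N * e₁ := by
    rw [← sum_sum_ite_ne_const N (g (σ ^ 3) * (Iχ * (Y * hsDiameter σ N ^ 3 * κ * Θb))), ← sum_sum_ite_ne_const N e₁]
    exact (abs_sum_sum_sub_le _ _).trans (Finset.sum_le_sum fun i _ => Finset.sum_le_sum fun j _ => hpair i j)
  -- Step 3: the density-weight error
  have herr : |∫ z, ∑ i, ∑ j, S2 i j z ∂G| ≤ 2 * L * 125 * (N + 1 : ℝ) * Cχ * (ζ' + 2 * Cg *
      P.real (sqDevEvent (N + 1) δ'' r)) := by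
    have hD := integral_sum_densityWeight_tubeMark_le (u := u) Φ hσ hσ2 ha hθ hχt hCχ hg hCg
      (by positivity : (0 : ℝ) ≤ σ ^ 3) hζ' hδ'' hmod k l hL hκ.le hLκ hr
    refine le_trans ?_ hD
    rw [← Real.norm_eq_abs]
    refine norm_integral_le_of_norm_le ?_ (ae_of_all _ fun z => ?_)
    · -- integrability of the dominating function (bounded, measurable)
      have hm : Measurable fun z : Config (N + 1) (Fin 3) T3 => ∑ i, ∑ j,
          if i ≠ j then |χ (t, (z i).1)| * |g (σ ^ 3 * empDensity r (fun m => (z m).1) (z i).1) - g (σ ^ 3)| *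
            |tubeMark κ (evenMarkTrunc k l L) ((hsDiameter σ N)⁻¹ • Torus.reprSym ((z i).1 - (z j).1))
              (z i).2 (z j).2| else 0 := by
        refine Finset.measurable_sum _ fun i _ => Finset.measurable_sum _ fun j _ => ?_
        refine Measurable.ite (MeasurableSet.const _) ?_ measurable_const
        exact ((hχim i).abs.mul (hgm i).abs).mul (hTMm i j).abs
      refine Integrable.of_bound hm.aestronglyMeasurable (((N + 1 : ℕ) : ℝ) * (((N + 1 : ℕ) : ℝ) *
        (Cχ * (2 * Cg) * (2 * L)))) (ae_of_all _ fun z => ?_)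
      rw [Real.norm_eq_abs, abs_of_nonneg (Finset.sum_nonneg fun i _ => Finset.sum_nonneg fun j _ => by
        split_ifs
        · positivity
        · exact le_rfl)]
      calc _ ≤ ∑ _i : Fin (N + 1), ∑ _j : Fin (N + 1), Cχ * (2 * Cg) * (2 * L) := by
            refine Finset.sum_le_sum fun i _ => Finset.sum_le_sum fun j _ => ?_
            split_ifs
            · exact mul_le_mul (mul_le_mul (hCχ _) (hgb i z) (abs_nonneg _) hCχ0) (hTMb i j z) (abs_nonneg _)
                (by positivity)
            · positivity
        _ = _ := by simp only [Finset.sum_const, Finset.card_univ, Fintype.card_fin, nsmul_eq_mul]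
    · rw [Real.norm_eq_abs]
      refine (Finset.abs_sum_le_sum_abs _ _).trans (Finset.sum_le_sum fun i _ => ?_)
      refine (Finset.abs_sum_le_sum_abs _ _).trans (Finset.sum_le_sum fun j _ => ?_)
      simp only [hS2def]
      split_ifs
      · rw [abs_mul, abs_mul]
        exact le_of_eq rfl
      · rw [abs_zero]
  -- Step 4: algebra
  have hNε : (N : ℝ) * hsDiameter σ N ^ 3 ≤ σ ^ 3 := by
    have h3 : 0 ≤ hsDiameter σ N ^ 3 := by positivity
    calc (N : ℝ) * hsDiameter σ N ^ 3 ≤ ((N + 1 : ℕ) : ℝ) * hsDiameter σ N ^ 3 :=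
          mul_le_mul_of_nonneg_right (by push_cast; linarith) h3
      _ = σ ^ 3 := hnε
  have hε3 : hsDiameter σ N ^ 3 = σ ^ 3 / (N + 1 : ℝ) := by
    rw [eq_div_iff (by positivity), mul_comm]
    exact_mod_cast hnε
  have hnκ : 0 < (N + 1 : ℝ) * κ := by positivity
  -- the three error terms after the prefactor `((N+1)κ)⁻¹`
  have hn1 : (0 : ℝ) < (N : ℝ) + 1 := by positivity
  have hcancel : ((N : ℝ) + 1)⁻¹ * ((N : ℝ) + 1) = 1 := inv_mul_cancel₀ hn1.ne'
  have hκc : κ⁻¹ * κ = 1 := inv_mul_cancel₀ hκ.ne'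
  have hT1 : ((N + 1 : ℝ) * κ)⁻¹ * (((N + 1 : ℕ) : ℝ) * N * e₁) ≤
      σ ^ 3 * Cg * Cχ * (2 * L * (2 * L) * σS) * ζ := by
    have e : ((N + 1 : ℝ) * κ)⁻¹ * (((N + 1 : ℕ) : ℝ) * N * e₁) =
        (N : ℝ) * hsDiameter σ N ^ 3 * (Cg * Cχ * (2 * L * (2 * L) * σS) * ζ) := by
      rw [he₁]
      push_cast
      calc (((N : ℝ) + 1) * κ)⁻¹ * (((N : ℝ) + 1) * N *
            (Cg * (Cχ * (ζ * hsDiameter σ N ^ 3 * κ * (2 * L * (2 * L) * σS)))))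
          = (((N : ℝ) + 1)⁻¹ * ((N : ℝ) + 1)) * (κ⁻¹ * κ) *
              ((N : ℝ) * hsDiameter σ N ^ 3 * (Cg * Cχ * (2 * L * (2 * L) * σS) * ζ)) := by rw [mul_inv]; ring
        _ = _ := by rw [hcancel, hκc, one_mul, one_mul]
    rw [e]
    calc (N : ℝ) * hsDiameter σ N ^ 3 * (Cg * Cχ * (2 * L * (2 * L) * σS) * ζ)
        ≤ σ ^ 3 * (Cg * Cχ * (2 * L * (2 * L) * σS) * ζ) := mul_le_mul_of_nonneg_right hNε (by positivity)
      _ = _ := by ring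
  have hT2 : ((N + 1 : ℝ) * κ)⁻¹ * (2 * L * 125 * (N + 1 : ℝ) * Cχ * (ζ' + 2 * Cg * P.real (sqDevEvent (N + 1) δ'' r))) =
      κ⁻¹ * (2 * L * 125) * Cχ * (ζ' + 2 * Cg * P.real (sqDevEvent (N + 1) δ'' r)) := by
    set X := ζ' + 2 * Cg * P.real (sqDevEvent (N + 1) δ'' r) with hX
    rw [mul_inv, show ((N : ℝ) + 1)⁻¹ * κ⁻¹ * (2 * L * 125 * ((N : ℝ) + 1) * Cχ * X) =
      (((N : ℝ) + 1)⁻¹ * ((N : ℝ) + 1)) * (κ⁻¹ * (2 * L * 125) * Cχ * X) by ring, hcancel, one_mul]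
  have hT3 : |((N + 1 : ℝ) * κ)⁻¹ * (((N + 1 : ℕ) : ℝ) * N * (g (σ ^ 3) * (Iχ * (Y * hsDiameter σ N ^ 3 * κ * Θb)))) -
      σ ^ 3 * g (σ ^ 3) * Y * Θb * Iχ| ≤ σ ^ 3 / (N + 1 : ℝ) * Cg * Cχ * |Y| * |Θb| := by
    have e : ((N + 1 : ℝ) * κ)⁻¹ * (((N + 1 : ℕ) : ℝ) * N * (g (σ ^ 3) * (Iχ * (Y * hsDiameter σ N ^ 3 * κ * Θb)))) -
        σ ^ 3 * g (σ ^ 3) * Y * Θb * Iχ = -(hsDiameter σ N ^ 3 * (g (σ ^ 3) * Iχ * Y * Θb)) := by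
      set X : ℝ := g (σ ^ 3) * Iχ * Y * Θb * hsDiameter σ N ^ 3 with hX
      have hσ3 : σ ^ 3 = ((N : ℝ) + 1) * hsDiameter σ N ^ 3 := by rw [← hnε]; push_cast; ring
      have h1 : σ ^ 3 * g (σ ^ 3) * Y * Θb * Iχ = ((N : ℝ) + 1) * X := by
        rw [hX]
        calc σ ^ 3 * g (σ ^ 3) * Y * Θb * Iχ = (g (σ ^ 3) * Y * Θb * Iχ) * σ ^ 3 := by ring
          _ = (g (σ ^ 3) * Y * Θb * Iχ) * (((N : ℝ) + 1) * hsDiameter σ N ^ 3) := by rw [← hσ3]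
          _ = _ := by ring
      have h2 : ((N + 1 : ℝ) * κ)⁻¹ * (((N + 1 : ℕ) : ℝ) * N * (g (σ ^ 3) * (Iχ * (Y * hsDiameter σ N ^ 3 * κ * Θb)))) =
          (N : ℝ) * X := by
        rw [hX]
        push_cast
        calc (((N : ℝ) + 1) * κ)⁻¹ * (((N : ℝ) + 1) * N * (g (σ ^ 3) * (Iχ * (Y * hsDiameter σ N ^ 3 * κ * Θb))))
            = (((N : ℝ) + 1)⁻¹ * ((N : ℝ) + 1)) * (κ⁻¹ * κ) *
                ((N : ℝ) * (g (σ ^ 3) * Iχ * Y * Θb * hsDiameter σ N ^ 3)) := by rw [mul_inv]; ring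
          _ = _ := by rw [hcancel, hκc, one_mul, one_mul]
      rw [h1, h2, hX]
      ring
    rw [e, abs_neg, abs_mul, abs_of_nonneg (by positivity : 0 ≤ hsDiameter σ N ^ 3), hε3, abs_mul, abs_mul, abs_mul]
    have h1 : |g (σ ^ 3)| * |Iχ| * |Y| * |Θb| ≤ Cg * Cχ * |Y| * |Θb| :=
      mul_le_mul_of_nonneg_right (mul_le_mul_of_nonneg_right
        (mul_le_mul hgσ hχb (abs_nonneg _) hCg0) (abs_nonneg _)) (abs_nonneg _)
    calc σ ^ 3 / (N + 1 : ℝ) * (|g (σ ^ 3)| * |Iχ| * |Y| * |Θb|) ≤ σ ^ 3 / (N + 1 : ℝ) * (Cg * Cχ * |Y| * |Θb|) :=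
          mul_le_mul_of_nonneg_left h1 (by positivity)
      _ = _ := by ring
  -- conclusion
  rw [hI]
  set M := ∑ i, ∑ j, ∫ z, S1 i j z ∂G with hM
  set E := ∫ z, ∑ i, ∑ j, S2 i j z ∂G with hE
  set B := ((N + 1 : ℕ) : ℝ) * N * (g (σ ^ 3) * (Iχ * (Y * hsDiameter σ N ^ 3 * κ * Θb))) with hB
  have hsplit : ((N + 1 : ℝ) * κ)⁻¹ * (M + E) - σ ^ 3 * g (σ ^ 3) * Y * Θb * Iχ =
      ((N + 1 : ℝ) * κ)⁻¹ * (M - B) + ((N + 1 : ℝ) * κ)⁻¹ * E + (((N + 1 : ℝ) * κ)⁻¹ * B - σ ^ 3 * g (σ ^ 3) * Y * Θb * Iχ) := by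
    ring
  rw [hsplit]
  have hinv0 : 0 ≤ ((N + 1 : ℝ) * κ)⁻¹ := by positivity
  calc |((N + 1 : ℝ) * κ)⁻¹ * (M - B) + ((N + 1 : ℝ) * κ)⁻¹ * E + (((N + 1 : ℝ) * κ)⁻¹ * B - σ ^ 3 * g (σ ^ 3) * Y * Θb * Iχ)|
      ≤ |((N + 1 : ℝ) * κ)⁻¹ * (M - B)| + |((N + 1 : ℝ) * κ)⁻¹ * E| + |((N + 1 : ℝ) * κ)⁻¹ * B - σ ^ 3 * g (σ ^ 3) * Y * Θb * Iχ| :=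
        (abs_add_le _ _).trans (add_le_add (abs_add_le _ _) le_rfl)
    _ ≤ ((N + 1 : ℝ) * κ)⁻¹ * (((N + 1 : ℕ) : ℝ) * N * e₁) +
        ((N + 1 : ℝ) * κ)⁻¹ * (2 * L * 125 * (N + 1 : ℝ) * Cχ * (ζ' + 2 * Cg * P.real (sqDevEvent (N + 1) δ'' r))) +
        σ ^ 3 / (N + 1 : ℝ) * Cg * Cχ * |Y| * |Θb| := by
        refine add_le_add (add_le_add ?_ ?_) hT3
        · rw [abs_mul, abs_of_nonneg hinv0]
          exact mul_le_mul_of_nonneg_left hmain hinv0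
        · rw [abs_mul, abs_of_nonneg hinv0]
          exact mul_le_mul_of_nonneg_left herr hinv0
    _ ≤ _ := by rw [hT2]; exact add_le_add (add_le_add hT1 le_rfl) le_rfl

end Literature.MathematicalPhysics.KineticTheory

end
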